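import Summits.KontsevichZagierPeriods.KontsevichZagierPeriods.Theses.SymplecticScissors
import Literature.NumberTheory.Transcendental.AyoubPeriodSeries
import Literature.NumberTheory.Transcendental.AyoubPeriodSeriesKernel
import Literature.NumberTheory.Transcendental.AyoubPeriodSeriesPiAlgebraic
import Summits.KontsevichZagierPeriods.KontsevichZagierPeriods.Theorems.UnfoldedStokesStokesGenerationStubSpanToRepsAuxCoeff
import Mathlib.RingTheory.MvPowerSeries.Rename
import Mathlib.RingTheory.MvPowerSeries.Substitution

/-!
# `TypeAGeneration` (stmt-KontsevichZagierPeriods-18392), line `Sketch`, stub `stub_restrCOne` —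
part 1: the face map `G ↦ G|_{zᵢ=1}` is a ring homomorphism on absolutely summable series

Support file for the registered stub `stub_restrCOne` (S4) of the crux `TypeAGeneration`
(route SymplecticScissors, line `Sketch` = card stokes-compiler), on top of
`Literature/NumberTheory/Transcendental/AyoubPeriodSeries.lean`
(`AyoubRel.CSeries = ℂ[[z₀, z₁, …]]`, `AyoubRel.restrC i c = (·)|_{zᵢ = c}`, a coefficientwise
`tsum`).

On `ℓ¹ = {F ∈ ℂ[[z]] | Σ_a ‖F_a‖ < ∞}` (which contains the polynomials and Ayoub's algebra
`𝒪_{k-alg}(𝔻̄^∞)`) the face map `F ↦ F|_{zᵢ=1}` is a ring homomorphism: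

* additivity (`s4_restrC_add`), `1 ↦ 1`, monomials `z^a ↦ z^{a ∖ i}` (`s4_restrC_monomial`,
  `s4_restrC_C`, `s4_restrC_X`);
* **the product rule** `(F G)|_{zᵢ=1} = F|_{zᵢ=1} · G|_{zᵢ=1}` (`s4_restrC_mul`): at an
  exponent `b` with `bᵢ = 0`,
  `Σ_N Σ_{a + a' = b + N eᵢ} F_a G_{a'} = Σ_{β + β' = b} (Σ_n F_{β + n eᵢ}) (Σ_{n'} G_{β' + n' eᵢ})`
  by the finite rearrangement `antidiagonal (b + N eᵢ) ≃ antidiagonal b × antidiagonal N`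
  (`s4_sum_antidiagonal_add_single`) and the Cauchy product of absolutely convergent series on `ℕ`;
* `ℓ¹` is closed under products and powers (`s4_summable_norm_coeff_mul`, Cauchy product over
  `ℕ →₀ ℕ`; `s4_restrC_pow`);
* weights: for `ρ ≥ 1`,
  `Σ_b ‖(G|_{zᵢ=1})_b‖ ρ^b ≤ Σ_b Σ_n ‖G_{b + n eᵢ}‖ ρ^{b + n eᵢ} = Σ_a ‖G_a‖ ρ^a`
  (`s4_summable_weighted_restrC`).

Elementary bookkeeping (folklore); no definition is introduced.
-/

noncomputable section

-- `Summit.KontsevichZagierPeriods.KontsevichZagierPeriods.…` is the tree's mandated layout (single-conjunct summit).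
set_option linter.dupNamespace false

namespace Summit.KontsevichZagierPeriods.KontsevichZagierPeriods.TypeAGenerationLine

open Finsupp MvPowerSeries
open Literature.NumberTheory.Transcendental
open Literature.NumberTheory.Transcendental.AyoubRel
open Summit.KontsevichZagierPeriods.KontsevichZagierPeriods.Theses.SymplecticScissors (TypeAGeneration)

/-! ## Coefficients of `F|_{zᵢ=1}`; additivity; monomials -/

/-- `coeff_b (F|_{zᵢ=1}) = [bᵢ = 0] Σₙ coeff_{b + n eᵢ} F`. [folklore] -/
theorem s4_coeff_restrC_one (i : ℕ) (F : CSeries) (b : ℕ →₀ ℕ) :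
    coeff b (restrC i 1 F) = if b i = 0 then ∑' n : ℕ, coeff (b + single i n) F else 0 := by
  rw [StokesGenerationLine.coeff_restrC]
  simp only [one_pow, mul_one]

/-- The ray `n ↦ b + n eᵢ` is injective. [folklore] -/
theorem s4_ray_injective (b : ℕ →₀ ℕ) (i : ℕ) :
    Function.Injective fun n : ℕ => b + single i n := by
  intro m m' h
  have h' := DFunLike.congr_fun h i
  simpa using h'

/-- Along a ray the coefficients of an absolutely summable series are absolutely summable.
[folklore] -/
theorem s4_summable_ray {F : CSeries} (hF : Summable fun a : ℕ →₀ ℕ => ‖coeff a F‖)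
    (b : ℕ →₀ ℕ) (i : ℕ) : Summable fun n : ℕ => ‖coeff (b + single i n) F‖ :=
  hF.comp_injective (s4_ray_injective b i)

/-- `(A + B)|_{zᵢ=1} = A|_{zᵢ=1} + B|_{zᵢ=1}` for absolutely summable `A`, `B`. [folklore] -/
theorem s4_restrC_add (i : ℕ) {A B : CSeries}
    (hA : Summable fun a : ℕ →₀ ℕ => ‖coeff a A‖)
    (hB : Summable fun a : ℕ →₀ ℕ => ‖coeff a B‖) :
    restrC i 1 (A + B) = restrC i 1 A + restrC i 1 B := by
  -- adapted from `rre_restrC_add` (FurushoPentagonSectorToKernelRsfRealify.lean)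
  refine MvPowerSeries.ext fun a => ?_
  rw [map_add, s4_coeff_restrC_one, s4_coeff_restrC_one, s4_coeff_restrC_one]
  split_ifs with h
  · rw [← (s4_summable_ray hA a i).of_norm.tsum_add (s4_summable_ray hB a i).of_norm]
    refine tsum_congr fun n => ?_
    rw [map_add]
  · rw [add_zero]

/-- **Monomials restrict to monomials**: `(c z^a)|_{zᵢ=1} = c z^{a ∖ i}`. [folklore] -/
theorem s4_restrC_monomial (i : ℕ) (a : ℕ →₀ ℕ) (c : ℂ) :
    restrC i 1 (monomial a c : CSeries) = monomial (a.erase i) c := by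
  classical
  refine MvPowerSeries.ext fun b => ?_
  rw [s4_coeff_restrC_one, coeff_monomial]
  split_ifs with hb h h'
  · rw [tsum_eq_single (a i)]
    · rw [coeff_monomial, if_pos]
      rw [h, erase_add_single]
    · intro n hn
      rw [coeff_monomial, if_neg]
      intro e
      apply hn
      have e' := DFunLike.congr_fun e i
      simpa [hb] using e'
  · have h0 : ∀ n : ℕ, coeff (b + single i n) (monomial a c : CSeries) = 0 := fun n => by
      rw [coeff_monomial, if_neg]
      intro e
      apply h
      rw [← e, erase_add, erase_single, add_zero, erase_of_notMem_support]
      simpa using hb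
    simp only [h0, tsum_zero]
  · exact absurd (by rw [h']; exact erase_same) hb
  · rfl

/-- `(C c)|_{zᵢ=1} = C c`. [folklore] -/
theorem s4_restrC_C (i : ℕ) (c : ℂ) : restrC i 1 (C c : CSeries) = C c := by
  rw [← monomial_zero_eq_C_apply, s4_restrC_monomial, erase_zero]

/-- `1|_{zᵢ=1} = 1`. [folklore] -/
theorem s4_restrC_one (i : ℕ) : restrC i 1 (1 : CSeries) = 1 := by
  rw [← monomial_zero_one, s4_restrC_monomial, erase_zero]

/-- `z_l|_{zᵢ=1} = [l = i] 1 + [l ≠ i] z_l`. [folklore] -/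
theorem s4_restrC_X (i l : ℕ) :
    restrC i 1 (X l : CSeries) = if l = i then 1 else X l := by
  rw [X_def, s4_restrC_monomial]
  split_ifs with h
  · rw [h, erase_single, monomial_zero_one]
  · rw [erase_single_ne (Ne.symm h)]

/-! ## `ℓ¹` is closed under products; polynomials are in `ℓ¹` -/

/-- **`ℓ¹` is closed under products** (`Σ_c ‖(FG)_c‖ ≤ (Σ_a ‖F_a‖)(Σ_b ‖G_b‖)`, Cauchy product
over `ℕ →₀ ℕ`). [folklore] -/
theorem s4_summable_norm_coeff_mul {F G : CSeries} (hF : Summable fun a : ℕ →₀ ℕ => ‖coeff a F‖)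
    (hG : Summable fun a : ℕ →₀ ℕ => ‖coeff a G‖) :
    Summable fun a : ℕ →₀ ℕ => ‖coeff a (F * G)‖ := by
  -- adapted from `HasPolyradiusGtOne.mul` (AyoubPeriodSeriesLocalizing.lean), radius `1`
  set f : (ℕ →₀ ℕ) → ℝ := fun a => ‖coeff a F‖
  set g : (ℕ →₀ ℕ) → ℝ := fun a => ‖coeff a G‖
  have hprod : Summable fun x : (ℕ →₀ ℕ) × (ℕ →₀ ℕ) => f x.1 * g x.2 :=
    hF.mul_of_nonneg hG (fun _ => norm_nonneg _) fun _ => norm_nonneg _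
  refine (summable_sum_mul_antidiagonal_of_summable_mul hprod).of_nonneg_of_le
    (fun _ => norm_nonneg _) fun a => ?_
  rw [coeff_mul]
  refine (norm_sum_le _ _).trans (le_of_eq ?_)
  exact Finset.sum_congr rfl fun p _ => norm_mul _ _

/-- `ℓ¹` is closed under sums. [folklore] -/
theorem s4_summable_norm_coeff_add {F G : CSeries} (hF : Summable fun a : ℕ →₀ ℕ => ‖coeff a F‖)
    (hG : Summable fun a : ℕ →₀ ℕ => ‖coeff a G‖) :
    Summable fun a : ℕ →₀ ℕ => ‖coeff a (F + G)‖ :=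
  (hF.add hG).of_nonneg_of_le (fun _ => norm_nonneg _) fun a => by
    rw [map_add]
    exact norm_add_le _ _

/-- Polynomials are in `ℓ¹` (finitely many non-zero coefficients). [folklore] -/
theorem s4_summable_norm_coeff_coe (p : MvPolynomial ℕ ℂ) :
    Summable fun a : ℕ →₀ ℕ => ‖coeff a (p : CSeries)‖ := by
  refine summable_of_ne_finset_zero (s := p.support) fun a ha => ?_
  rw [MvPolynomial.coeff_coe, MvPolynomial.notMem_support_iff.mp ha, norm_zero]

/-! ## The product rule -/

/-- **Finite rearrangement** `antidiagonal (b + N eᵢ) ≃ antidiagonal b × antidiagonal N` for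
`bᵢ = 0`: `(a, a') ↦ ((a ∖ i, a' ∖ i), (aᵢ, a'ᵢ))`, inverse
`((β, β'), (n, n')) ↦ (β + n eᵢ, β' + n' eᵢ)`. [folklore] -/
theorem s4_sum_antidiagonal_add_single {M : Type*} [AddCommMonoid M] {b : ℕ →₀ ℕ} {i : ℕ}
    (hb : b i = 0) (N : ℕ) (φ : (ℕ →₀ ℕ) × (ℕ →₀ ℕ) → M) :
    ∑ p ∈ Finset.HasAntidiagonal.antidiagonal (b + single i N), φ p =
      ∑ q ∈ Finset.HasAntidiagonal.antidiagonal b, ∑ m ∈ Finset.HasAntidiagonal.antidiagonal N,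
        φ (q.1 + single i m.1, q.2 + single i m.2) := by
  have hbi : b.erase i = b := erase_of_notMem_support (by simpa using hb)
  rw [← Finset.sum_product (Finset.HasAntidiagonal.antidiagonal b)
    (Finset.HasAntidiagonal.antidiagonal N)
    (fun x => φ (x.1.1 + single i x.2.1, x.1.2 + single i x.2.2))]
  refine Finset.sum_nbij' (fun p => ((p.1.erase i, p.2.erase i), (p.1 i, p.2 i)))
    (fun x => (x.1.1 + single i x.2.1, x.1.2 + single i x.2.2)) ?_ ?_ ?_ ?_ ?_
  · intro p hp
    rw [Finset.HasAntidiagonal.mem_antidiagonal] at hp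
    rw [Finset.mem_product, Finset.HasAntidiagonal.mem_antidiagonal,
      Finset.HasAntidiagonal.mem_antidiagonal]
    refine ⟨?_, ?_⟩
    · change p.1.erase i + p.2.erase i = b
      rw [← erase_add, hp, erase_add, erase_single, add_zero, hbi]
    · change p.1 i + p.2 i = N
      rw [← Finsupp.add_apply, hp, Finsupp.add_apply, hb, single_eq_same, zero_add]
  · intro x hx
    rw [Finset.mem_product, Finset.HasAntidiagonal.mem_antidiagonal,
      Finset.HasAntidiagonal.mem_antidiagonal] at hx
    rw [Finset.HasAntidiagonal.mem_antidiagonal]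
    change (x.1.1 + single i x.2.1) + (x.1.2 + single i x.2.2) = b + single i N
    rw [add_add_add_comm, hx.1, ← single_add, hx.2]
  · intro p _
    change (p.1.erase i + single i (p.1 i), p.2.erase i + single i (p.2 i)) = p
    rw [erase_add_single, erase_add_single]
  · intro x hx
    rw [Finset.mem_product, Finset.HasAntidiagonal.mem_antidiagonal,
      Finset.HasAntidiagonal.mem_antidiagonal] at hx
    have h1 : x.1.1 i = 0 := by
      have h := DFunLike.congr_fun hx.1 i
      rw [Finsupp.add_apply, hb] at h
      omega
    have h2 : x.1.2 i = 0 := by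
      have h := DFunLike.congr_fun hx.1 i
      rw [Finsupp.add_apply, hb] at h
      omega
    change (((x.1.1 + single i x.2.1).erase i, (x.1.2 + single i x.2.2).erase i),
      ((x.1.1 + single i x.2.1) i, (x.1.2 + single i x.2.2) i)) = x
    rw [erase_add, erase_add, erase_single, erase_single, add_zero, add_zero,
      erase_of_notMem_support (by simpa using h1), erase_of_notMem_support (by simpa using h2),
      Finsupp.add_apply, Finsupp.add_apply, h1, h2, single_eq_same, single_eq_same, zero_add,
      zero_add]
  · intro p _
    change φ p = φ (p.1.erase i + single i (p.1 i), p.2.erase i + single i (p.2 i))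
    rw [erase_add_single, erase_add_single]

/-- **The product rule for the face map** on absolutely summable series:
`(F G)|_{zᵢ=1} = F|_{zᵢ=1} · G|_{zᵢ=1}` (finite rearrangement of each slice, then the Cauchy product
of the absolutely convergent ray series `Σ_n F_{β + n eᵢ}`, `Σ_{n'} G_{β' + n' eᵢ}`). [folklore] -/
theorem s4_restrC_mul {F G : CSeries} (hF : Summable fun a : ℕ →₀ ℕ => ‖coeff a F‖)
    (hG : Summable fun a : ℕ →₀ ℕ => ‖coeff a G‖) (i : ℕ) :
    restrC i 1 (F * G) = restrC i 1 F * restrC i 1 G := by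
  refine MvPowerSeries.ext fun b => ?_
  rw [s4_coeff_restrC_one, coeff_mul]
  split_ifs with hb
  · have hq : ∀ q ∈ Finset.HasAntidiagonal.antidiagonal b, q.1 i = 0 ∧ q.2 i = 0 := by
      intro q hq
      rw [Finset.HasAntidiagonal.mem_antidiagonal] at hq
      have h := DFunLike.congr_fun hq i
      rw [Finsupp.add_apply, hb] at h
      omega
    calc ∑' N : ℕ, coeff (b + single i N) (F * G)
        = ∑' N : ℕ, ∑ q ∈ Finset.HasAntidiagonal.antidiagonal b,
            ∑ m ∈ Finset.HasAntidiagonal.antidiagonal N,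
              coeff (q.1 + single i m.1) F * coeff (q.2 + single i m.2) G := by
          refine tsum_congr fun N => ?_
          rw [coeff_mul]
          exact s4_sum_antidiagonal_add_single hb N _
      _ = ∑ q ∈ Finset.HasAntidiagonal.antidiagonal b,
            ∑' N : ℕ, ∑ m ∈ Finset.HasAntidiagonal.antidiagonal N,
              coeff (q.1 + single i m.1) F * coeff (q.2 + single i m.2) G := by
          refine Summable.tsum_finsetSum fun q _ => ?_
          exact (summable_norm_sum_mul_antidiagonal_of_summable_norm
            (s4_summable_ray hF q.1 i) (s4_summable_ray hG q.2 i)).of_norm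
      _ = ∑ q ∈ Finset.HasAntidiagonal.antidiagonal b, (∑' n : ℕ, coeff (q.1 + single i n) F) *
            ∑' n : ℕ, coeff (q.2 + single i n) G := by
          refine Finset.sum_congr rfl fun q _ => ?_
          exact (tsum_mul_tsum_eq_tsum_sum_antidiagonal_of_summable_norm
            (s4_summable_ray hF q.1 i) (s4_summable_ray hG q.2 i)).symm
      _ = ∑ q ∈ Finset.HasAntidiagonal.antidiagonal b,
            coeff q.1 (restrC i 1 F) * coeff q.2 (restrC i 1 G) := by
          refine Finset.sum_congr rfl fun q hq' => ?_
          rw [s4_coeff_restrC_one, s4_coeff_restrC_one, if_pos (hq q hq').1, if_pos (hq q hq').2]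
  · symm
    refine Finset.sum_eq_zero fun q hq => ?_
    rw [Finset.HasAntidiagonal.mem_antidiagonal] at hq
    have h := DFunLike.congr_fun hq i
    rw [Finsupp.add_apply] at h
    by_cases h1 : q.1 i = 0
    · have h2 : q.2 i ≠ 0 := by omega
      rw [s4_coeff_restrC_one i G, if_neg h2, mul_zero]
    · rw [s4_coeff_restrC_one i F, if_neg h1, zero_mul]

/-! ## Powers -/

/-- `ℓ¹` is closed under powers. [folklore] -/
theorem s4_summable_norm_coeff_pow {F : CSeries} (hF : Summable fun a : ℕ →₀ ℕ => ‖coeff a F‖)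
    (n : ℕ) : Summable fun a : ℕ →₀ ℕ => ‖coeff a (F ^ n)‖ := by
  induction n with
  | zero =>
    have h := s4_summable_norm_coeff_coe 1
    rw [MvPolynomial.coe_one] at h
    rw [pow_zero]
    exact h
  | succ n ih =>
    rw [pow_succ]
    exact s4_summable_norm_coeff_mul ih hF

/-- **Powers**: `(F^n)|_{zᵢ=1} = (F|_{zᵢ=1})^n` on `ℓ¹`. [folklore] -/
theorem s4_restrC_pow {F : CSeries} (hF : Summable fun a : ℕ →₀ ℕ => ‖coeff a F‖) (i n : ℕ) :
    restrC i 1 (F ^ n) = restrC i 1 F ^ n := by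
  induction n with
  | zero => rw [pow_zero, pow_zero, s4_restrC_one]
  | succ n ih => rw [pow_succ, pow_succ, s4_restrC_mul (s4_summable_norm_coeff_pow hF n) hF, ih]

/-! ## Weights: `Σ_b ‖(G|_{zᵢ=1})_b‖ ρ^b ≤ Σ_a ‖G_a‖ ρ^a` for `ρ ≥ 1` -/

section Weights

/-- The weight `ρ^a = ∏_l ρ_l^{a_l}` is multiplicative. [folklore] -/
theorem s4_weight_add (ρ : ℕ → ℝ) (a b : ℕ →₀ ℕ) :
    ((a + b).prod fun l n => ρ l ^ n) = (a.prod fun l n => ρ l ^ n) * b.prod fun l n => ρ l ^ n :=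
  Finsupp.prod_add_index' (fun _ => pow_zero _) fun _ _ _ => pow_add _ _ _

/-- `ρ^{n eᵢ} = ρᵢ^n`. [folklore] -/
theorem s4_weight_single (ρ : ℕ → ℝ) (i n : ℕ) :
    ((single i n).prod fun l m => ρ l ^ m) = ρ i ^ n :=
  Finsupp.prod_single_index (pow_zero _)

/-- `ρ^a ≥ 1` for `ρ ≥ 1`. [folklore] -/
theorem s4_one_le_weight {ρ : ℕ → ℝ} (hρ : ∀ l, 1 ≤ ρ l) (a : ℕ →₀ ℕ) :
    1 ≤ a.prod fun l n => ρ l ^ n := by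
  unfold Finsupp.prod
  calc (1 : ℝ) = ∏ _l ∈ a.support, (1 : ℝ) := Finset.prod_const_one.symm
    _ ≤ ∏ l ∈ a.support, ρ l ^ a l :=
        Finset.prod_le_prod (fun _ _ => zero_le_one) fun l _ => one_le_pow₀ (hρ l)

/-- The constant weight `r` is `r^{|a|}`. [folklore] -/
theorem s4_prod_const_pow (r : ℝ) (a : ℕ →₀ ℕ) : (a.prod fun _ n => r ^ n) = r ^ degree a := by
  rw [Finsupp.prod, Finset.prod_pow_eq_pow_sum, Finsupp.degree_apply]

/-- **Anisotropic weights `ρ ≥ 1` summable for `G` are summable for `G|_{zᵢ=1}`**: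
`‖Σ_n G_{b + n eᵢ}‖ ρ^b ≤ Σ_n ‖G_{b + n eᵢ}‖ ρ^{b + n eᵢ}` (`ρᵢ ≥ 1`) and `(b, n) ↦ b + n eᵢ` is
injective on `{bᵢ = 0}` (reindexing `a ↦ (a ∖ i, aᵢ)` of the summable family `‖G_a‖ ρ^a`).
[folklore] -/
theorem s4_summable_weighted_restrC {G : CSeries} {ρ : ℕ → ℝ} (hρ : ∀ l, 1 ≤ ρ l)
    (hs : Summable fun a : ℕ →₀ ℕ => ‖coeff a G‖ * a.prod fun l n => ρ l ^ n) (i : ℕ) :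
    Summable fun a : ℕ →₀ ℕ => ‖coeff a (restrC i 1 G)‖ * a.prod fun l n => ρ l ^ n := by
  -- adapted from `StokesGenerationLine.summable_norm_coeff_restrC` (weights added)
  classical
  set W : (ℕ →₀ ℕ) → ℝ := fun a => a.prod fun l n => ρ l ^ n with hW
  have hW1 : ∀ a, 1 ≤ W a := fun a => s4_one_le_weight hρ a
  have hW0 : ∀ a, 0 ≤ W a := fun a => zero_le_one.trans (hW1 a)
  have hG1 : Summable fun a : ℕ →₀ ℕ => ‖coeff a G‖ :=
    hs.of_nonneg_of_le (fun _ => norm_nonneg _) fun a =>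
      le_mul_of_one_le_right (norm_nonneg _) (hW1 a)
  set g : (ℕ →₀ ℕ) → ℝ := fun b => ‖coeff b G‖ * W b with hg
  set h : (ℕ →₀ ℕ) × ℕ → ℝ := fun p => if p.1 i = 0 then g (p.1 + single i p.2) else 0 with hh
  set ψ : (ℕ →₀ ℕ) → (ℕ →₀ ℕ) × ℕ := fun b => (b.erase i, b i) with hψ
  have hψinj : Function.Injective ψ := by
    intro b b' e
    simp only [hψ, Prod.mk.injEq] at e
    rw [← erase_add_single i b, ← erase_add_single i b', e.1, e.2]
  have hψcomp : ∀ b, h (ψ b) = g b := by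
    intro b
    simp only [hh, hψ, erase_same, if_true, erase_add_single]
  have hrange : ∀ p, p ∉ Set.range ψ → h p = 0 := by
    rintro ⟨a, n⟩ hp
    simp only [hh]
    split_ifs with ha
    · exact absurd ⟨a + single i n, by
        simp only [hψ, Prod.mk.injEq, erase_add_single_self, Finsupp.add_apply, single_eq_same,
          ha, zero_add, and_true]
        exact erase_of_notMem_support (by simpa using ha)⟩ hp
    · rfl
  have hhs : Summable h := by
    refine (hψinj.summable_iff hrange).mp ?_
    have e : h ∘ ψ = g := funext hψcomp
    rw [e]
    exact hs
  have hh0 : ∀ p, 0 ≤ h p := fun p => by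
    simp only [hh]
    split_ifs
    · exact mul_nonneg (norm_nonneg _) (hW0 _)
    · exact le_rfl
  refine (hhs.prod).of_nonneg_of_le (fun a => mul_nonneg (norm_nonneg _) (hW0 a)) fun a => ?_
  change ‖coeff a (restrC i 1 G)‖ * W a ≤ ∑' n, h (a, n)
  rw [s4_coeff_restrC_one]
  split_ifs with ha
  · have hsum_n : Summable fun n => h (a, n) := hhs.prod_factor a
    have hray : Summable fun n : ℕ => ‖coeff (a + single i n) G‖ := s4_summable_ray hG1 a i
    have hle : ∀ n, ‖coeff (a + single i n) G‖ * W a ≤ h (a, n) := fun n => by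
      simp only [hh, if_pos ha, hg, hW]
      rw [s4_weight_add, s4_weight_single]
      exact mul_le_mul_of_nonneg_left (le_mul_of_one_le_right (hW0 a) (one_le_pow₀ (hρ i)))
        (norm_nonneg _)
    calc ‖∑' n : ℕ, coeff (a + single i n) G‖ * W a
        ≤ (∑' n : ℕ, ‖coeff (a + single i n) G‖) * W a :=
          mul_le_mul_of_nonneg_right (norm_tsum_le_tsum_norm hray) (hW0 a)
      _ = ∑' n : ℕ, ‖coeff (a + single i n) G‖ * W a := tsum_mul_right.symm
      _ ≤ ∑' n : ℕ, h (a, n) := Summable.tsum_le_tsum hle (hray.mul_right _) hsum_n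
  · rw [norm_zero, zero_mul]
    exact tsum_nonneg fun n => hh0 _

end Weights

/-! ## Registered form -/

/-- **Registered auxiliary stub** `stub_restrCOneAux` (sub-goal of `stub_restrCOne`, crux
stmt-KontsevichZagierPeriods-18392): on series with absolutely summable coefficients the face map
`F ↦ F|_{zᵢ=1}` is additive and multiplicative (= `s4_restrC_add`, `s4_restrC_mul`). [folklore] -/
theorem stub_restrCOneAux :
    ∀ (F G : MvPowerSeries ℕ ℂ) (i : ℕ),
      Summable (fun a : ℕ →₀ ℕ => ‖MvPowerSeries.coeff a F‖) →
      Summable (fun a : ℕ →₀ ℕ => ‖MvPowerSeries.coeff a G‖) →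
      AyoubRel.restrC i 1 (F + G) = AyoubRel.restrC i 1 F + AyoubRel.restrC i 1 G ∧
        AyoubRel.restrC i 1 (F * G) = AyoubRel.restrC i 1 F * AyoubRel.restrC i 1 G :=
  fun _ _ i hF hG => ⟨s4_restrC_add i hF hG, s4_restrC_mul hF hG i⟩

end Summit.KontsevichZagierPeriods.KontsevichZagierPeriods.TypeAGenerationLine
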